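import Literature.AnabelianGeometry.AbsoluteAnabelian.MLFReciprocityCharacterizedProofs
import Literature.NumberTheory.GaloisRepresentations.CyclotomicCharacterArtinNormProofs
import Literature.NumberTheory.GaloisRepresentations.LocalArtinMapPinned
import Literature.NumberTheory.GaloisRepresentations.LocalArtinMapUnique
import Literature.NumberTheory.GaloisRepresentations.LocalKroneckerWeberInertiaProofs
import HarnessLib

/-!
# `χ_p ∘ θ_E = N_{E/ℚ_p}⁻¹` on units: the reciprocity map of a finite Galois level, read against the
# cyclotomic character (VOCABULARY BRIDGE recSystemE-characterised `Art` ↔ `canonicalArtin`)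

Proof-only file (abc-iut cell, layer L4 / LCFT lane; GAP-LEDGER row G-L6d2-1 «`MLFClosure.norm_liftM_eq`»,
STAGE 1 of abc-iut-w6-d012's plan, STATUS 2026-08-26T07:30Z).  S. Mochizuki, *Inter-universal Teichmüller
theory II*, §1, Remark 1.8.1, kurims manuscript p. 42 l. 1–6: «the composite with the `p`-adic logarithm of the
cyclotomic character of `G` determines … a natural surjection `O^{×μ}(G) ↠ ℚ_p`, which [cf. [AbsAnab],
Proposition 1.2.1, (vi)] is `Aut(G)`-equivariant»; the classical input behind «determines» is
`χ_cyc ∘ Art_k = N_{k/ℚ_p}⁻¹` on `𝒪_k^×` (J.-P. Serre, *Local class field theory*, Cassels–Fröhlich Ch. VI,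
§3.1 Thm. 2 with §2.4; *Local Fields* XIII §4 Prop. 10).

The tree holds the two ends of that identity in two vocabularies:
* the reciprocity maps the [AbsAnab] Prop. 1.2.1 lane consumes — `Art : E₀ˣ → Gal(F̄/E₀)^ab` CHARACTERISED by
  Neukirch's norm residue symbols `LocalWeilDatum.recSystemE` (abc-iut-L6-t11,
  `exists_reciprocity_characterized_embField`, clause 4), i.e. by the limit map
  `θ_E = (isReciprocitySystemE hcf).theta` (`IsReciprocitySystem.absGaloisAbProj_eq_theta_iff`);
* `cyclotomicCharacter_artin_eq_norm_holds` — `ε_p(w) = N_{F/ℚ_p}(canonicalArtin w)` on inertia, for THE pinned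
  Artin map in Deligne's normalisation (Lubin–Tate).
This file proves the bridge: for EVERY reciprocity system `ω` of a characteristic-`0` `p`-adic field `F`,
its limit map `θ` satisfies **`χ_p(γ) = N_{F/ℚ_p}(x)⁻¹` whenever `[γ] = θ x` with `x ∈ 𝒪_Fˣ`**
(`IsReciprocitySystem.cyclotomicCharacter_eq_norm_inv`) — because the Artin map of `θ`
(`IsLocalReciprocityMap.artin`, `artin w = (θ⁻¹[w])⁻¹`) has the five clauses (`isLocalArtinMap_artin`) hence IS
`canonicalArtin F` (`IsLocalArtinMap.unique_holds`) — and transfers it to every `Art` characterised by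
`recSystemE` at a finite Galois level `E/F` (`cyclotomicCharacter_eq_norm_inv_of_art_eq`, both with `χ_p` of
`Γ_E` at the lift `liftGal h` and with `χ_p` of `Γ_F` at `h` itself, `cyclotomicCharacter_absGaloisRestrict`).
Helper: `χ_p` factors through `Γ^ab` (`cyclotomicCharacter_eq_of_absGaloisAbProj_eq`).

Classical local class field theory; theorems only, no definitions, no named facts; universe `0` (that of
`cyclotomicCharacter_artin_eq_norm`).  HONEST FRAMING: nothing here bears on [IUTchIII] Cor. 3.12; no side taken.
-/

noncomputable section

open Field IsNonarchimedeanLocalField ValuativeRel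
open scoped Pointwise

namespace Literature.AnabelianGeometry.AbsoluteAnabelian

open Literature.NumberTheory.GaloisRepresentations
open Literature.NumberTheory.GaloisRepresentations.LocalWeilDatum
open AbstractCFT AbstractCFT.WeilDatum

/-! ### `χ_p` factors through the topological abelianisation -/

/-- The `p`-adic cyclotomic character takes the same value on two elements of `Γ_F` with the same image in
`Γ_F^ab = Γ_F ⧸ closure [Γ_F, Γ_F]` (continuous homomorphism to the abelian Hausdorff group `ℤ_pˣ`).
[cite: SerreLocalFields1979, Ch. XIII §4] -/
theorem cyclotomicCharacter_eq_of_absGaloisAbProj_eq (F : Type*) [Field F] (p : ℕ) [Fact p.Prime]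
    {γ γ' : absoluteGaloisGroup F} (h : absGaloisAbProj F γ = absGaloisAbProj F γ') :
    GaloisRep.cyclotomicCharacter F p γ = GaloisRep.cyclotomicCharacter F p γ' := by
  have hmem : γ⁻¹ * γ' ∈ (commutator (absoluteGaloisGroup F)).topologicalClosure := QuotientGroup.eq.mp h
  have hker : IsClosed (((GaloisRep.cyclotomicCharacter F p).toMonoidHom.ker : Subgroup (absoluteGaloisGroup F)) :
      Set (absoluteGaloisGroup F)) := by
    rw [MonoidHom.coe_ker]
    exact isClosed_singleton.preimage (GaloisRep.cyclotomicCharacter F p).continuous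
  have hle : (commutator (absoluteGaloisGroup F)).topologicalClosure ≤
      (GaloisRep.cyclotomicCharacter F p).toMonoidHom.ker :=
    Subgroup.topologicalClosure_minimal _ (Abelianization.commutator_subset_ker _) hker
  have h1 : GaloisRep.cyclotomicCharacter F p (γ⁻¹ * γ') = 1 := hle hmem
  rwa [map_mul, map_inv, inv_mul_eq_one] at h1

/-! ### The core bridge: `χ_p(γ) = N(x)⁻¹` for `[γ] = θ x`, `x` a unit -/

section Core

variable {F : Type} [Field F] [ValuativeRel F] [TopologicalSpace F] [IsNonarchimedeanLocalField F] [CharZero F]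
variable {ω : (L : IntermediateField F (AlgebraicClosure F)) → Fˣ →* (L ≃ₐ[F] L)}

/-- **`χ_p ∘ θ = N_{F/ℚ_p}⁻¹` on `𝒪_Fˣ`** for the limit map `θ` of ANY reciprocity system `ω` of a
characteristic-`0` local field `F` with `|p|_F < 1` (canonical `ℚ_p`-algebra structure): if `[γ] = θ x` in `Γ_F^ab`
with `x ∈ 𝒪_Fˣ` then `χ_p(γ) = N_{F/ℚ_p}(x)⁻¹` in `ℚ_p`.  Proof: the Artin map of `θ` (`artin w = (θ⁻¹[w])⁻¹`)
has the five characterising clauses (`isLocalArtinMap_artin`), so it is `canonicalArtin F`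
(`IsLocalArtinMap.unique_holds`); `x⁻¹ = artin w` for an inertia element `w` (`image_inertia`), `[γ] = [w]`
(`theta_artin_inv`), and `χ_p(w) = N(artin w)` (`cyclotomicCharacter_artin_eq_norm_holds`, Lubin–Tate).
[cite: SerreLCFT1967, §3.1 Thm. 2 (p. 146) with §2.4 and §3.4 Thm. 3 (c)] -/
theorem _root_.Literature.NumberTheory.GaloisRepresentations.IsReciprocitySystem.cyclotomicCharacter_eq_norm_inv
    (hω : IsReciprocitySystem F ω) (p : ℕ) [Fact p.Prime]
    (hp : valuation F p < 1) {x : Fˣ} (hx : x ∈ (valuation F).valuationSubring.unitGroup)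
    {γ : absoluteGaloisGroup F} (hγ : absGaloisAbProj F γ = hω.theta x) :
    letI := LocalField.padicAlgebra F p hp
    (((GaloisRep.cyclotomicCharacter F p γ : ℤ_[p]ˣ) : ℤ_[p]) : ℚ_[p]) = (Algebra.norm ℚ_[p] (x : F))⁻¹ := by
  letI := LocalField.padicAlgebra F p hp
  -- the Artin map of `θ` and its five clauses
  have hθ : IsLocalReciprocityMap F hω.theta :=
    hω.isLocalReciprocityMap_theta (universalNormSubgroup_eq_bot F) (isClosed_of_isNormSubgroup_holds F)
  have hart : IsLocalArtinMap F hθ.artin :=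
    hω.isLocalArtinMap_artin hθ (WeilGroup.denseRange_toAbsGalois_holds F)
  -- `x⁻¹` is a unit, hence `artin w` for an inertia element `w`
  have hx' : x⁻¹ ∈ (WeilGroup.inertia F).map hθ.artin := by
    rw [hart.image_inertia]
    exact inv_mem hx
  obtain ⟨w, hw, hwx⟩ := Subgroup.mem_map.mp hx'
  -- `[γ] = θ x = θ (artin w)⁻¹ = [w]`
  have h1 : absGaloisAbProj F γ = absGaloisAbProj F (WeilGroup.toAbsGalois F w) := by
    rw [hγ, ← hθ.theta_artin_inv w, hwx, inv_inv]
  rw [cyclotomicCharacter_eq_of_absGaloisAbProj_eq F p h1]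
  -- THE pinned Artin map is `hθ.artin`
  have hcan : canonicalArtin F = hθ.artin := canonicalArtin_eq (IsLocalArtinMap.unique_holds F) hart
  have h3 := cyclotomicCharacter_artin_eq_norm_holds F p hp
    (LocalArtinData.ofExistsIsLocalArtinMap (exists_isLocalArtinMap_holds F))
    (LocalArtinData.isCanonical_ofExistsIsLocalArtinMap _) w hw
  -- `h3 : χ_p(w) = N (canonicalArtin F w)`
  rw [h3]
  change Algebra.norm ℚ_[p] ((canonicalArtin F w : Fˣ) : F) = _
  rw [hcan, hwx, Units.val_inv_eq_inv_val]
  have hmul : Algebra.norm ℚ_[p] ((x : F)⁻¹) * Algebra.norm ℚ_[p] (x : F) = 1 := by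
    rw [← map_mul, inv_mul_cancel₀ (Units.ne_zero x), map_one]
  exact eq_inv_of_mul_eq_one_left hmul

end Core

/-! ### Transfer to the reciprocity maps characterised by `recSystemE` at a finite Galois level -/

section Level

variable (F E : Type) [Field F] [ValuativeRel F] [TopologicalSpace F] [IsNonarchimedeanLocalField F]
  [Field E] [Algebra F E] [FiniteDimensional F E] [Algebra.IsSeparable F E]
  [ValuativeRel E] [TopologicalSpace E] [IsNonarchimedeanLocalField E] [ValuativeExtension F E] [CharZero E]

/-- **`χ_p(liftGal h) = N_{E/ℚ_p}(u)⁻¹` whenever `Art u = [h]`, `u ∈ 𝒪_Eˣ`**, for EVERY `Art : E₀ˣ → Gal(F̄/E₀)^ab`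
characterised by the norm residue symbols of `E` read in the Weil datum of `F` (clause 4 of
`exists_reciprocity_characterized_embField`; the shape consumed by `Prop121vii.levelwise_of_isAlphaEquivariant`):
clause 4 says `liftGal h` represents `θ_E (ι⁻¹ u)` for `θ_E = (isReciprocitySystemE hcf).theta`
(`IsReciprocitySystem.absGaloisAbProj_eq_theta_iff`), and `cyclotomicCharacter_eq_norm_inv` applies.
[cite: SerreLCFT1967, §3.1 Thm. 2 (p. 146) with §2.4] -/
theorem cyclotomicCharacter_liftGal_eq_norm_inv_of_art_eq (p : ℕ) [Fact p.Prime] (hp : valuation E p < 1)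
    {Art : (embField F E)ˣ →* TopologicalAbelianization (galFixing F (embField F E))}
    (hchar : ∀ (u : (embField F E)ˣ) (h : galFixing F (embField F E)),
      Art u = QuotientGroup.mk h ↔
        ∀ (L' : IntermediateField E (AlgebraicClosure E)) [FiniteDimensional E L'] [IsAbelianGalois E L'],
          AlgEquiv.restrictNormalHom L' (absoluteGaloisGroup.toAlgEquiv E (liftGal F E h.2)) =
            recSystemE (isClassFieldTheory_localWeilDatum F) L'
              (Units.map ((equivEmbField F E).symm : embField F E →* E) u))
    {u : (embField F E)ˣ}
    (hu : Units.map ((equivEmbField F E).symm : embField F E →* E) u ∈ (valuation E).valuationSubring.unitGroup)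
    {h : galFixing F (embField F E)} (hArt : Art u = QuotientGroup.mk h) :
    letI := LocalField.padicAlgebra E p hp
    (((GaloisRep.cyclotomicCharacter E p (liftGal F E h.2) : ℤ_[p]ˣ) : ℤ_[p]) : ℚ_[p]) =
      (Algebra.norm ℚ_[p] (((Units.map ((equivEmbField F E).symm : embField F E →* E) u : Eˣ) : E)))⁻¹ := by
  have hω := isReciprocitySystemE (F := F) (E := E) (isClassFieldTheory_localWeilDatum F)
  have hmem : liftGal F E h.2 ∈ hω.Reps (Units.map ((equivEmbField F E).symm : embField F E →* E) u) :=
    hω.mem_reps_iff.mpr ((hchar u h).mp hArt)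
  exact hω.cyclotomicCharacter_eq_norm_inv p hp hu (hω.absGaloisAbProj_eq_theta_iff.mpr hmem)

/-- The same with the cyclotomic character of the BASE field `F` at `h ∈ Gal(F̄/E₀) ≤ Γ_F` itself (for `F` of
characteristic `0`): `χ_p(h) = N_{E/ℚ_p}(u)⁻¹` — `χ_p` is compatible with restriction
(`cyclotomicCharacter_absGaloisRestrict`, `res (liftGal h) = h`).  This is the form [AbsAnab] Prop. 1.2.1 (vi)
(`galoisMLF_iso_cyclotomicChar_holds`, `χ ∘ α = χ` on `Γ_F`) composes with.
[cite: SerreLCFT1967, §3.1 Thm. 2 (p. 146) with §2.4] -/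
theorem cyclotomicCharacter_eq_norm_inv_of_art_eq [CharZero F] (p : ℕ) [Fact p.Prime] (hp : valuation E p < 1)
    {Art : (embField F E)ˣ →* TopologicalAbelianization (galFixing F (embField F E))}
    (hchar : ∀ (u : (embField F E)ˣ) (h : galFixing F (embField F E)),
      Art u = QuotientGroup.mk h ↔
        ∀ (L' : IntermediateField E (AlgebraicClosure E)) [FiniteDimensional E L'] [IsAbelianGalois E L'],
          AlgEquiv.restrictNormalHom L' (absoluteGaloisGroup.toAlgEquiv E (liftGal F E h.2)) =
            recSystemE (isClassFieldTheory_localWeilDatum F) L'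
              (Units.map ((equivEmbField F E).symm : embField F E →* E) u))
    {u : (embField F E)ˣ}
    (hu : Units.map ((equivEmbField F E).symm : embField F E →* E) u ∈ (valuation E).valuationSubring.unitGroup)
    {h : galFixing F (embField F E)} (hArt : Art u = QuotientGroup.mk h) :
    letI := LocalField.padicAlgebra E p hp
    (((GaloisRep.cyclotomicCharacter F p (h : absoluteGaloisGroup F) : ℤ_[p]ˣ) : ℤ_[p]) : ℚ_[p]) =
      (Algebra.norm ℚ_[p] (((Units.map ((equivEmbField F E).symm : embField F E →* E) u : Eˣ) : E)))⁻¹ := by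
  haveI : NeZero (p : F) := ⟨Nat.cast_ne_zero.mpr (Fact.out : p.Prime).ne_zero⟩
  have hres : GaloisRep.cyclotomicCharacter F p (h : absoluteGaloisGroup F) =
      GaloisRep.cyclotomicCharacter E p (liftGal F E h.2) := by
    rw [← cyclotomicCharacter_absGaloisRestrict F E p (liftGal F E h.2), absGaloisRestrict_liftGal]
  rw [hres]
  exact cyclotomicCharacter_liftGal_eq_norm_inv_of_art_eq F E p hp hchar hu hArt

end Level

end Literature.AnabelianGeometry.AbsoluteAnabelian

end
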